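import Summits.CriticalPhenomena.SAWScalingLimit.Theorems.SAWTotalPositivityCriticalBubbleBoundJoinRotate
import Summits.CriticalPhenomena.SAWScalingLimit.Theorems.SAWTotalPositivityCriticalBubbleBoundJoinReflect

/-!
# Hammond's Lemma 4.9 in the class model: tall-left classes are at least a quarter of all classes
(crux `SAWTotalPositivity.CriticalBubbleBound`, stmt-CriticalPhenomena-7117; line `docking-census-joining`,
registered stub `card_lexRooted_le_four_mul` of the join-mass programme, lead prover c6)

For every walk length `n ≥ 3`, `#lexRooted n ≤ 4 · #{χ ∈ lexRooted n : IsLeftPoly n χ}`: the quarter-turn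
transport `lexRooted_transport_rot` (exchanging height and width) injects the wide classes into the tall
ones, so at least half of the classes are tall; the vertical-flip transport `lexRooted_transport_vrefl`
(preserving height, width and `ymin + ymax`, and sending the lowest rightmost row to the highest) injects
the tall classes whose tip lies in the lower half into the left ones, so at least half of the tall classes
are left. [cite: Hammond2015SAPJoining, Lemma 4.9]
-/

noncomputable section

open Literature.Probability.LatticeModels
open Literature.Probability.RandomPlanarGeometry Literature.Probability.RandomPlanarGeometry.SAW
open scoped BigOperators
open Summit.CriticalPhenomena.SAWScalingLimit.Theorems.CriticalBubbleBound.Negative (e₀)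
open Summit.CriticalPhenomena.SAWScalingLimit.Theorems.CriticalBubbleBound.Docking

namespace Summit.CriticalPhenomena.SAWScalingLimit.Theorems.CriticalBubbleBound.Join

/-- Counting through an injection of one filtered class into another: if `F` is injective on `L` and
maps `L.filter p` into `L.filter q`, then `#(L.filter p) ≤ #(L.filter q)`. [folklore] -/
private theorem card_filter_le_of_maps {L : Finset (ℕ → Site 2)} {p q : (ℕ → Site 2) → Prop}
    [DecidablePred p] [DecidablePred q] (F : (ℕ → Site 2) → (ℕ → Site 2))
    (hinj : Set.InjOn F ↑L) (hmap : ∀ χ ∈ L, p χ → F χ ∈ L ∧ q (F χ)) :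
    (L.filter p).card ≤ (L.filter q).card := by
  refine Finset.card_le_card_of_injOn F (fun χ hχ => ?_) (hinj.mono ?_)
  · rw [Finset.mem_coe, Finset.mem_filter] at hχ
    rw [Finset.mem_coe, Finset.mem_filter]
    exact hmap χ hχ.1 hχ.2
  · intro χ hχ
    exact (Finset.mem_filter.1 hχ).1

/-- The row of `ES` is at most the tip row. [folklore] -/
private theorem esRow_le_tipRow (n : ℕ) (χ : ℕ → Site 2) : esRow n χ ≤ tipRow n χ := by
  obtain ⟨v, hv, hv1⟩ := exists_eq_tipRow n χ
  exact hv1 ▸ esRow_le hv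

open Classical in
/-- **Hammond's Lemma 4.9 in the class model** (registered stub `card_lexRooted_le_four_mul`): for
`n ≥ 3`, the tall classes whose highest rightmost vertex lies in the upper half (`IsLeftPoly`) are at
least a quarter of all lex-rooted classes of walk length `n`. [cite: Hammond2015SAPJoining, Lemma 4.9] -/
theorem card_lexRooted_le_four_mul : ∀ n : ℕ, 3 ≤ n →
    (lexRooted n).card ≤ 4 * ((lexRooted n).filter (IsLeftPoly n)).card := by
  intro n hn
  set L := lexRooted n
  -- (a) at least half of the classes are tall
  obtain ⟨F, hFinj, hF⟩ := lexRooted_transport_rot n hn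
  have htall : (L.filter fun χ => ¬ IsTall n χ).card ≤ (L.filter (IsTall n)).card := by
    refine card_filter_le_of_maps F hFinj fun χ hχ hnot => ?_
    obtain ⟨hmem, hw, hh⟩ := hF χ hχ
    refine ⟨hmem, ?_⟩
    simp only [IsTall, not_le] at hnot ⊢
    rw [hw, hh]
    exact hnot.le
  have hsplit₁ : L.card = (L.filter (IsTall n)).card + (L.filter fun χ => ¬ IsTall n χ).card :=
    (Finset.card_filter_add_card_filter_not _).symm
  -- (b) at least half of the tall classes are left
  obtain ⟨G, hGinj, hG⟩ := lexRooted_transport_vrefl n hn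
  have hleft : (L.filter fun χ => IsTall n χ ∧ ¬ IsLeftPoly n χ).card ≤ (L.filter (IsLeftPoly n)).card := by
    refine card_filter_le_of_maps G hGinj fun χ hχ hp => ?_
    obtain ⟨hmem, hw, hh, hsum, htip⟩ := hG χ hχ
    obtain ⟨ht, hnl⟩ := hp
    refine ⟨hmem, ?_, ?_⟩
    · simp only [IsTall] at ht ⊢
      rw [hw, hh]
      exact ht
    · have hlt : 2 * tipRow n χ < ymin n χ + ymax n χ := by
        simp only [IsLeftPoly, not_and, not_le] at hnl
        exact hnl ht
      have hes := esRow_le_tipRow n χ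
      rw [hsum, htip]
      linarith
  have hsplit₂ : (L.filter (IsTall n)).card =
      (L.filter (IsLeftPoly n)).card + (L.filter fun χ => IsTall n χ ∧ ¬ IsLeftPoly n χ).card := by
    have h1 : (L.filter (IsTall n)).filter (IsLeftPoly n) = L.filter (IsLeftPoly n) := by
      ext χ
      simp only [Finset.mem_filter, IsLeftPoly]
      tauto
    have h2 : (L.filter (IsTall n)).filter (fun χ => ¬ IsLeftPoly n χ) =
        L.filter fun χ => IsTall n χ ∧ ¬ IsLeftPoly n χ := by
      ext χ
      simp only [Finset.mem_filter, and_assoc]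
    rw [← h1, ← h2]
    exact (Finset.card_filter_add_card_filter_not _).symm
  omega

end Summit.CriticalPhenomena.SAWScalingLimit.Theorems.CriticalBubbleBound.Join

end
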